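import Summits.BirchSwinnertonDyer.BirchSwinnertonDyer.Theses.ClassRecordThree
import Summits.BirchSwinnertonDyer.BirchSwinnertonDyer.Theorems.ErratumRoadFiveNonSurjCornerTwinMuAnUnitValue
import Literature.NumberTheory.EllipticCurves.PAdicBSD
import HarnessLib

/-!
# Line «anchors» — crux `CornerTwistMuAnAtThree` (stmt-BirchSwinnertonDyer-23543; CR3 r706 / KR3 r806)

LINE-WRITER SKELETON (linewriter-bsd-display13-1 g0, 2026-08-31); NOT leaf progress; BSD is proved for no curve.

The crux (route decl `Theses.ClassRecordThree.CornerTwistMuAnAtThree` := the Theorems constant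
`Theorems.CornerAtThreeTwistMuAn`): analytic `μ = 0` at `p = 3`, in the Néron–MTT normalisation
«some coefficient of `ϖ·L₃(f, a)` is a `3`-adic unit», for every odd Heegner twin `Wd = Cd • E^{(d_K)}` of a
(T4″)@3 corner curve `E` (`ClassX11b E 3 ∧ ¬ Surj E 3`), `a = a₃(Wd) = ±1` the allowable root.

CUT «certificate-or-transfer, by the sign of the twin at 3» (the sign of `Wd` at `3` is that of `E`, `χ_{d_K}(3) = +1`):
* NON-SPLIT (`a = −1`, no exceptional zero; `[T⁰](ϖL) = 2·ϖ·[0]⁺_f`):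
  - ON the unit-value locus `‖ϖ·[0]⁺_f‖₃ = 1` the constant term is the unit coefficient — LANDED, used BY NAME:
    `Theorems.cornerAtThreeTwistMuAn_nonsplit_of_unit_value` (no stub);
  - OFF it (`λ ≥ 1`): RESEARCH stub `stub_nonsplitRowsOffUnitValue` (congruence transfer from a unit-value partner in the
    mod-3 Hesse pencil; EPW 2006 Thm 1 across a good-ordinary ↔ 3-new pair; period bookkeeping at `3 ∥ N`).
* SPLIT (`a = 1`, exceptional zero `[T⁰] = 0`; `[T¹]·log₃ γ = ℒ₃(Wd)·[0]⁺_f` by Greenberg–Stevens at `3` = Kobayashi 2006 Cor. 4.2,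
  tree fact `greenberg_stevens Wd 3`):
  - ON the unit-derivative locus `∃ Dq, ‖ℒ₃(Dq)·ϖ·[0]⁺_f‖₃ = ‖log₃ γ‖₃` the linear coefficient is the unit — PRINT stub
    `stub_splitRowsOfUnitDerivative` [print: Kobayashi2006DocMath Cor. 4.2; tree `greenberg_stevens`, `LInvariant_ne_zero_holds`];
  - OFF it: RESEARCH stub `stub_splitRowsOffUnitDerivative` (no local certificate survives — every good-ordinary member of
    `H(ρ̄)` has `a₃ ≡ 1 (mod 3)`, anomalous; only transfer from an anchored member: the CM anchor on the subclass S⋆ of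
    corner3-p2 g17 §3, whose input (P3) «cyclotomic μ = 0 for 3-ordinary CM families» is presumed open).
Prior design credited: corner-p1 g7 `HOME/bsd-stepL/corner/g7/bc3/CornerAtThreeTwistMuAn_birth.lean` (nonsplit ∕ split, r2/p0,
never registered); this cut refines each half by its certificate locus, so the research stubs are strictly smaller.
-/

set_option autoImplicit false
set_option linter.dupNamespace false

noncomputable section

namespace Summit.BirchSwinnertonDyer.BirchSwinnertonDyer.Cruxes.CornerTwistMuAnAtThree.Anchors

open CongruenceSubgroup WeierstrassCurve Literature.NumberTheory.EllipticCurves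
  Literature.NumberTheory.EllipticCurves.ModularForms Literature.NumberTheory.EllipticCurves.Rank1Residual
  Summit.BirchSwinnertonDyer.Rank1Residual

/-! ## Stubs -/

/-- **[print] `stub_splitRowsOfUnitDerivative`** — SPLIT twins ON the unit-derivative locus: if some Tate parameter datum
`Dq` of `Wd` at `3` has `‖ℒ₃(Dq) · ϖ · [0]⁺_f‖₃ = ‖log₃ γ‖₃`, then `[T¹](ϖ·L)` is a `3`-adic unit. Print: Kobayashi 2006
Cor. 4.2 (`greenberg_stevens Wd 3`: `[T¹]L · log₃ γ = ℒ₃ · [0]⁺_f`, exceptional zero `[T⁰] = 0`), `log₃ γ ≠ 0`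
(`padicLog_cyclotomicGenerator_ne_zero`); S-sized algebra. FLAG: GS-at-3 is Kobayashi's corollary, not GS93 (`p ≥ 5`).
[cite: Kobayashi2006DocMath, Cor. 4.2] [cite: GreenbergStevens1993, Thm. (0.3)] -/
theorem stub_splitRowsOfUnitDerivative :
    ∀ (W : WeierstrassCurve ℚ) [W.IsElliptic] [W.IsGloballyMinimal] (K : Type) [Field K] [NumberField K]
      (Wd : WeierstrassCurve ℚ) [Wd.IsElliptic] [Wd.IsGloballyMinimal] (Cd : VariableChange ℚ),
      ClassX11b W 3 → ¬ Surj W 3 → IsImaginaryQuadratic K → Odd (NumberField.discr K) →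
      SatisfiesHeegnerHypothesis (W.conductorNorm ℤ) K →
      (W.quadraticTwist (NumberField.discr K : ℚ)).entireLFunction 1 ≠ 0 →
      Cd • W.quadraticTwist (NumberField.discr K : ℚ) = Wd →
      Wd.HasSplitMultiplicativeReductionAtPrime 3 →
      ∀ {N : ℕ} [NeZero N] (f : CuspForm (Gamma0 N) 2), IsNewformOf Wd f →
      ∀ (ϖ : ℚ), (ϖ : ℝ) * Wd.realPeriodRat = plusPeriod f →
      (∃ Dq : TateParameterData Wd 3,
          ‖LInvariant Dq * (((ϖ : ℚ) : ℚ_[3]) * (ratPlusSymbol f 0 : ℚ_[3]))‖ =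
            ‖padicLog 3 (cyclotomicGenerator 3 : ℚ_[3])‖) →
      ∀ (L : PowerSeries ℚ_[3]), IsMultPAdicLFunctionOf f 3 1 L →
        ∃ n : ℕ, ‖PowerSeries.coeff n (PowerSeries.C ((ϖ : ℚ) : ℚ_[3]) * L)‖ = 1 := by
  sorry

/-- **[research] `stub_nonsplitRowsOffUnitValue`** — NON-SPLIT twins OFF the unit-value locus (`‖ϖ·[0]⁺_f‖₃ ≠ 1`,
i.e. `λ ≥ 1`): the MTT function `ϖ·L₃(f, −1)` still has a unit coefficient. Technique: congruence transfer — an elliptic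
partner `A` in the mod-3 Hesse pencil `X_{Wd[3]}(3) ≅ ℙ¹` (Rubin–Silverberg 1995), good ordinary at `3` (then
`a₃(A) ≡ −1 (mod 3)`, non-anomalous automatically) with `3`-adic unit `L(A,1)/Ω_A`, whose `λ` is absorbed by its own bad
primes (Greenberg–Vatsal `λ`-formula); EPW 2006 Thm. 1 across the good-ordinary ↔ `3`-new pair; period bookkeeping at
`3 ∥ N` (Agashe–Ribet–Stein; `realPeriodRat_eq_unit_mul_plusPeriod_three` on the `A` side). Why it might fail: the
partner supply is an open ∀∃; SU-(ram) anchors are void on every congruence class of a corner twist (corner3-p2 g17 F1).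
[cite: EmertonPollackWeston2006, Thm. 1] [cite: GreenbergVatsal2000, Thm. (1.4), §3 Rem. (3.4)] [cite: RubinSilverberg1995, Thm. 4.1] -/
theorem stub_nonsplitRowsOffUnitValue :
    ∀ (W : WeierstrassCurve ℚ) [W.IsElliptic] [W.IsGloballyMinimal] (K : Type) [Field K] [NumberField K]
      (Wd : WeierstrassCurve ℚ) [Wd.IsElliptic] [Wd.IsGloballyMinimal] (Cd : VariableChange ℚ),
      ClassX11b W 3 → ¬ Surj W 3 → IsImaginaryQuadratic K → Odd (NumberField.discr K) →
      SatisfiesHeegnerHypothesis (W.conductorNorm ℤ) K →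
      (W.quadraticTwist (NumberField.discr K : ℚ)).entireLFunction 1 ≠ 0 →
      Cd • W.quadraticTwist (NumberField.discr K : ℚ) = Wd →
      ¬ Wd.HasSplitMultiplicativeReductionAtPrime 3 →
      ∀ {N : ℕ} [NeZero N] (f : CuspForm (Gamma0 N) 2), IsNewformOf Wd f →
      ∀ (ϖ : ℚ), (ϖ : ℝ) * Wd.realPeriodRat = plusPeriod f →
      ‖((ϖ : ℚ) : ℚ_[3]) * (ratPlusSymbol f 0 : ℚ_[3])‖ ≠ 1 →
      ∀ (L : PowerSeries ℚ_[3]), IsMultPAdicLFunctionOf f 3 (-1) L →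
        ∃ n : ℕ, ‖PowerSeries.coeff n (PowerSeries.C ((ϖ : ℚ) : ℚ_[3]) * L)‖ = 1 := by
  sorry

/-- **[research] `stub_splitRowsOffUnitDerivative`** — SPLIT twins OFF the unit-derivative locus: the split MTT
function `ϖ·L₃(f, 1)` (exceptional zero at `T = 0`) still has a unit coefficient. No local certificate survives here
(every good-ordinary member of `H(ρ̄)` has `a₃ ≡ 1 (mod 3)`, anomalous), so the only road is transfer from an ANCHORED
member of the Hida family `H(ρ̄_E ⊗ χ_d)`: the CM anchor `g_d` on the subclass S⋆ (corner3-p2 g17 §3: 129/296 classes),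
whose input (P3) «cyclotomic `μ = 0` for `3`-ordinary CM families» is presumed open (Gillard 1987 / Schneps 1987 /
Oukhaba–Viguié 2016 give the split-prime tower only), or an elliptic partner with a certified unit LEADING coefficient.
Why it might fail: (P3) open; on the 3Nn classes no CM anchor exists (g17 F2) and SU-(ram) anchors are void (F1).
[cite: EmertonPollackWeston2006, Thm. 1] [cite: GreenbergLNM1716, §1 Conj. 1.11] [cite: Kobayashi2006DocMath, Cor. 4.2] -/
theorem stub_splitRowsOffUnitDerivative :
    ∀ (W : WeierstrassCurve ℚ) [W.IsElliptic] [W.IsGloballyMinimal] (K : Type) [Field K] [NumberField K]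
      (Wd : WeierstrassCurve ℚ) [Wd.IsElliptic] [Wd.IsGloballyMinimal] (Cd : VariableChange ℚ),
      ClassX11b W 3 → ¬ Surj W 3 → IsImaginaryQuadratic K → Odd (NumberField.discr K) →
      SatisfiesHeegnerHypothesis (W.conductorNorm ℤ) K →
      (W.quadraticTwist (NumberField.discr K : ℚ)).entireLFunction 1 ≠ 0 →
      Cd • W.quadraticTwist (NumberField.discr K : ℚ) = Wd →
      Wd.HasSplitMultiplicativeReductionAtPrime 3 →
      ∀ {N : ℕ} [NeZero N] (f : CuspForm (Gamma0 N) 2), IsNewformOf Wd f →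
      ∀ (ϖ : ℚ), (ϖ : ℝ) * Wd.realPeriodRat = plusPeriod f →
      (¬ ∃ Dq : TateParameterData Wd 3,
          ‖LInvariant Dq * (((ϖ : ℚ) : ℚ_[3]) * (ratPlusSymbol f 0 : ℚ_[3]))‖ =
            ‖padicLog 3 (cyclotomicGenerator 3 : ℚ_[3])‖) →
      ∀ (L : PowerSeries ℚ_[3]), IsMultPAdicLFunctionOf f 3 1 L →
        ∃ n : ℕ, ‖PowerSeries.coeff n (PowerSeries.C ((ϖ : ℚ) : ℚ_[3]) * L)‖ = 1 := by
  sorry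

/-! ## Composition (sorry-free): the three stubs + the landed unit-value theorem give the crux BY NAME -/

/-- **`CornerTwistMuAnAtThree_of`** — case split on the sign of the twin at `3`, then on the certificate locus. -/
theorem CornerTwistMuAnAtThree_of :
    Summit.BirchSwinnertonDyer.BirchSwinnertonDyer.Theses.ClassRecordThree.CornerTwistMuAnAtThree := by
  show Summit.BirchSwinnertonDyer.BirchSwinnertonDyer.Theorems.CornerAtThreeTwistMuAn
  intro W _ _ K _ _ Wd _ _ Cd hX hns hK hodd hHN hLt hWd N _ f hf ϖ hϖ a L hsa hna hL
  by_cases hsplit : Wd.HasSplitMultiplicativeReductionAtPrime 3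
  · have ha : a = 1 := hsa hsplit
    subst ha
    by_cases hcert : ∃ Dq : TateParameterData Wd 3,
        ‖LInvariant Dq * (((ϖ : ℚ) : ℚ_[3]) * (ratPlusSymbol f 0 : ℚ_[3]))‖ =
          ‖padicLog 3 (cyclotomicGenerator 3 : ℚ_[3])‖
    · exact stub_splitRowsOfUnitDerivative W K Wd Cd hX hns hK hodd hHN hLt hWd hsplit f hf ϖ hϖ hcert L hL
    · exact stub_splitRowsOffUnitDerivative W K Wd Cd hX hns hK hodd hHN hLt hWd hsplit f hf ϖ hϖ hcert L hL
  · have ha : a = -1 := hna hsplit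
    subst ha
    by_cases hunit : ‖((ϖ : ℚ) : ℚ_[3]) * (ratPlusSymbol f 0 : ℚ_[3])‖ = 1
    · exact Summit.BirchSwinnertonDyer.BirchSwinnertonDyer.Theorems.cornerAtThreeTwistMuAn_nonsplit_of_unit_value
        W K Wd Cd hX hns hK hodd hHN hLt hWd hsplit f hf ϖ hϖ L hL hunit
    · exact stub_nonsplitRowsOffUnitValue W K Wd Cd hX hns hK hodd hHN hLt hWd hsplit f hf ϖ hϖ hunit L hL

end Summit.BirchSwinnertonDyer.BirchSwinnertonDyer.Cruxes.CornerTwistMuAnAtThree.Anchors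

end
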